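import Literature.MathematicalPhysics.QuantumLattice.DuhamelEqualTimeBounds
import Literature.MathematicalPhysics.QuantumLattice.GibbsStationaritySlack
import HarnessLib

/-!
# Bogoliubov's inequality for a finite-dimensional Gibbs state: general (non-Hermitian) observables

Companion of `BogoliubovInequality.lean` / `BogoliubovInequalityDuhamel.lean`, which prove
Bogoliubov's inequality for HERMITIAN `A`, `C` (the Mermin–Wagner use). The inequality as printed
by Dyson–Lieb–Simon ([DLS1978] eq. (28)) is for ARBITRARY operators,

  `|⟨[C, A]⟩|² ≤ ½β ⟨A Aᴴ + Aᴴ A⟩ · ⟨[Cᴴ, [H, C]]⟩`,   `⟨X⟩ = tr(e^{-βH} X)/Z`,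

and this general form is what a semidefinite moment relaxation of a thermal state consumes: for a
finite family of (non-Hermitian) template operators it is ONE positive-semidefinite block that is
LINEAR in the moments (hubbard-thermal THERMAL-SOURCES.md §2g, row family `bog`). This file proves,
for a Hermitian `H : Matrix n n ℂ`, `β ≥ 0` and arbitrary `A C : Matrix n n ℂ`:

* `trace_gibbsWeight_mul_commutator_eq_sum` — the pair-sum form
  `tr(e^{-βH}(CA − AC)) = Σᵢⱼ (wᵢ − wⱼ) C′ᵢⱼ A′ⱼᵢ` (`X′ = U⋆XU`, `wᵢ = e^{−βEᵢ}`);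
* `re_gibbsState_doubleComm_general` — `Re ⟨[Cᴴ,[H,C]]⟩ = Z⁻¹ Σᵢⱼ |C′ᵢⱼ|² (Eⱼ − Eᵢ)(wᵢ − wⱼ)`
  (hence `≥ 0`, `re_gibbsState_doubleComm_general_nonneg`; [DLS1978] after (28));
* `bogoliubov_inequality_duhamel_general` — the sharp (Duhamel) form
  `|⟨CA − AC⟩|² ≤ β · Re (Aᴴ, A) · Re ⟨[Cᴴ,[H,C]]⟩` ([DLS1978] (22′) + (27): Schwarz for the Duhamel
  two-point function `(Aᴴ, A) = Matrix.duhamel β H Aᴴ A`);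
* `bogoliubov_inequality_general` — [DLS1978] (28):
  `|⟨CA − AC⟩|² ≤ β · ½(Re⟨AAᴴ⟩ + Re⟨AᴴA⟩) · Re ⟨[Cᴴ,[H,C]]⟩` (from the sharp form by
  `(Aᴴ, A) ≤ ½⟨AAᴴ + AᴴA⟩`, [DLS1978] (25) = tree `re_duhamel_conjTranspose_le`), and the variant
  `bogoliubov_inequality_general'` with `⟨AAᴴ + AᴴA⟩` as one expectation;
* `bogoliubov_row_nonneg` — the LINEAR row form
  `0 ≤ Re⟨AAᴴ + AᴴA⟩ + 2 Re⟨CA − AC⟩ + ½β Re⟨[Cᴴ,[H,C]]⟩` (AM–GM on the previous item; ranging over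
  all `A`, `C` in the span of a template family this is the positive-semidefiniteness of the
  Bogoliubov block of THERMAL-SOURCES §2g (G-5)).

## References

* [DLS1978] F. J. Dyson, E. H. Lieb, B. Simon, *Phase transitions in quantum spin systems with
  isotropic and nonisotropic interactions*, J. Stat. Phys. 18 (1978) 335–383, §2: (22′) Schwarz
  inequality for the Duhamel two-point function, (25) `(A*,A) ≤ ½⟨A*A + AA*⟩`, (27)
  `⟨[A,B]⟩ = ([A,βH],B)`, (28) Bogoliubov's inequality for arbitrary `A`, `B`, and the positivity
  `⟨[A*,[βH,A]]⟩ ≥ 0` with its eigenfunction expansion (held: `paper:doi-10-1007-978-3-662-10018-9-12`,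
  pp. 11–13).
* N. N. Bogoliubov, Phys. Abh. Sowjetunion 6 (1962) 1, 113, 229.
* H. Fawzi, O. Fawzi, S. O. Scalet, *Certified algorithms for equilibrium states of local quantum
  Hamiltonians*, Nat. Commun. (2024), arXiv:2311.18706, Thm. 3.4 (the matrix energy–entropy balance
  constraint, which implies these rows on the same operator span — THERMAL-SOURCES §2g (G-5)).

## Design notes

Everything is over `ℂ`, `[Fintype n] [DecidableEq n]`, in the vocabulary of `FinDimSpectrum.lean`
(`Matrix.gibbsWeight/partitionFn/gibbsState`) and `DuhamelTwoPoint.lean` (`Matrix.duhamel`,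
`Matrix.duhamelKernel`); the proofs are the pair-sum / Cauchy–Schwarz argument of
`BogoliubovInequality.lean` with the Hermitian bookkeeping `|A′ᵢⱼ| = |A′ⱼᵢ|` replaced by the two
pair sums `Re tr(e^{-βH}AAᴴ) = Σ wᵢ|A′ᵢⱼ|²`, `Re tr(e^{-βH}AᴴA) = Σ wⱼ|A′ᵢⱼ|²`
(`GibbsTwoTimeBound.lean`) and the commutator row `Re tr(e^{-βH}Aᴴ[H,A]) = Σ wⱼ(Eᵢ−Eⱼ)|A′ᵢⱼ|²`
(`GibbsStationaritySlack.lean`). No definition, no named fact.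
-/

noncomputable section

open scoped Matrix.Norms.L2Operator ComplexOrder
open Finset MeasureTheory intervalIntegral Matrix

namespace Literature.MathematicalPhysics.QuantumLattice

variable {n : Type*} [Fintype n] [DecidableEq n] {H : Matrix n n ℂ}

section Spectral

omit [DecidableEq n] in
/-- Rotating an adjoint: `U⋆ Xᴴ U = (U⋆ X U)ᴴ`. [folklore] -/
private theorem star_coe_mul_conjTranspose_mul [DecidableEq n] (hH : H.IsHermitian) (X : Matrix n n ℂ) :
    (star hH.eigenvectorUnitary : Matrix n n ℂ) * Xᴴ * (hH.eigenvectorUnitary : Matrix n n ℂ) =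
      ((star hH.eigenvectorUnitary : Matrix n n ℂ) * X * (hH.eigenvectorUnitary : Matrix n n ℂ))ᴴ := by
  rw [Matrix.conjTranspose_mul, Matrix.conjTranspose_mul, Matrix.star_eq_conjTranspose,
    Matrix.conjTranspose_conjTranspose, Matrix.mul_assoc]

/-- **Pair-sum form of the commutator expectation for arbitrary observables**:
`tr(e^{-βH} (CA − AC)) = Σᵢⱼ (wᵢ − wⱼ) C′ᵢⱼ A′ⱼᵢ` with `X′ = U⋆XU`, `wᵢ = e^{-βEᵢ}` in an
eigenbasis of `H` (the generalisation of `trace_gibbsWeight_mul_comm_sub` to non-Hermitian `A`;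
it is [DLS1978] (27) `⟨[A,B]⟩ = ([A,βH],B)` written out in the energy eigenbasis).
[cite: DLS1978, §2 eq. (27)] -/
theorem trace_gibbsWeight_mul_commutator_eq_sum (hH : H.IsHermitian) (A C : Matrix n n ℂ) (β : ℝ) :
    (gibbsWeight β H * (C * A - A * C)).trace =
      ∑ i, ∑ j, ((Real.exp (-(β * hH.eigenvalues i)) - Real.exp (-(β * hH.eigenvalues j)) : ℝ) : ℂ) *
        (((star hH.eigenvectorUnitary : Matrix n n ℂ) * C * (hH.eigenvectorUnitary : Matrix n n ℂ)) i j *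
          ((star hH.eigenvectorUnitary : Matrix n n ℂ) * A * (hH.eigenvectorUnitary : Matrix n n ℂ)) j i) := by
  set U : Matrix n n ℂ := (hH.eigenvectorUnitary : Matrix n n ℂ) with hU
  have hUm : U ∈ unitary (Matrix n n ℂ) := hH.eigenvectorUnitary.prop
  set A' : Matrix n n ℂ := star U * A * U with hA'
  set C' : Matrix n n ℂ := star U * C * U with hC'
  set e : n → ℂ := fun i => (Real.exp (-β * hH.eigenvalues i) : ℂ) with he
  have hCA : (gibbsWeight β H * (C * A)).trace = ∑ i, ∑ j, e i * (C' i j * A' j i) := by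
    rw [trace_gibbsWeight_mul_eq_sum hH β (C * A), star_unitary_mul_mul_mul hUm C A]
    refine sum_congr rfl fun i _ => ?_
    rw [Matrix.mul_apply, Finset.mul_sum]
  have hAC : (gibbsWeight β H * (A * C)).trace = ∑ i, ∑ j, e j * (C' i j * A' j i) := by
    rw [trace_gibbsWeight_mul_eq_sum hH β (A * C), star_unitary_mul_mul_mul hUm A C]
    have h1 : ∑ i, e i * (A' * C') i i = ∑ i, ∑ j, e i * (A' i j * C' j i) := by
      refine sum_congr rfl fun i _ => ?_
      rw [Matrix.mul_apply, Finset.mul_sum]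
    rw [h1, Finset.sum_comm]
    refine sum_congr rfl fun i _ => sum_congr rfl fun j _ => ?_
    ring
  rw [Matrix.mul_sub, Matrix.trace_sub, hCA, hAC, ← Finset.sum_sub_distrib]
  refine sum_congr rfl fun i _ => ?_
  rw [← Finset.sum_sub_distrib]
  refine sum_congr rfl fun j _ => ?_
  simp only [he, neg_mul]
  push_cast
  ring

/-- **Pair-sum form of the double commutator for an arbitrary observable**:
`Re ⟨[Cᴴ, [H, C]]⟩_β = Z⁻¹ Σᵢⱼ |C′ᵢⱼ|² (Eⱼ − Eᵢ)(wᵢ − wⱼ)`, `C′ = U⋆CU`, `wᵢ = e^{-βEᵢ}` — the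
eigenfunction expansion printed after [DLS1978] (28) (there with `βH`). The proof splits
`[Cᴴ,[H,C]] = Cᴴ[H,C] − [H,C]Cᴴ`, uses stationarity `⟨[H, CCᴴ]⟩ = 0` to rewrite
`−⟨[H,C]Cᴴ⟩ = ⟨C[H,Cᴴ]⟩`, and adds the two commutator rows of `GibbsStationaritySlack.lean`.
[cite: DLS1978, §2 after eq. (28)] -/
theorem re_gibbsState_doubleComm_general (hH : H.IsHermitian) (C : Matrix n n ℂ) (β : ℝ) :
    (gibbsState β H (Cᴴ * (H * C - C * H) - (H * C - C * H) * Cᴴ)).re =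
      (∑ i, Real.exp (-(β * hH.eigenvalues i)))⁻¹ *
        ∑ i, ∑ j, ‖((star hH.eigenvectorUnitary : Matrix n n ℂ) * C *
            (hH.eigenvectorUnitary : Matrix n n ℂ)) i j‖ ^ 2 *
          ((hH.eigenvalues j - hH.eigenvalues i) *
            (Real.exp (-(β * hH.eigenvalues i)) - Real.exp (-(β * hH.eigenvalues j)))) := by
  set C' : Matrix n n ℂ := (star hH.eigenvectorUnitary : Matrix n n ℂ) * C *
    (hH.eigenvectorUnitary : Matrix n n ℂ) with hC'
  set E : n → ℝ := hH.eigenvalues with hE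
  -- stationarity: `⟨(HC − CH)Cᴴ⟩ = −⟨Cᴴᴴ(HCᴴ − CᴴH)⟩`
  have hstat : gibbsState β H ((H * C - C * H) * Cᴴ) =
      -gibbsState β H (Cᴴᴴ * (H * Cᴴ - Cᴴ * H)) := by
    rw [conjTranspose_conjTranspose]
    have h0 : gibbsState β H (H * (C * Cᴴ) - C * Cᴴ * H) = 0 := by
      rw [map_sub, gibbsState_hamiltonian_mul, sub_self]
    have h1 : (H * C - C * H) * Cᴴ + C * (H * Cᴴ - Cᴴ * H) = H * (C * Cᴴ) - C * Cᴴ * H := by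
      simp only [Matrix.sub_mul, Matrix.mul_sub, Matrix.mul_assoc]
      abel
    have h2 : gibbsState β H ((H * C - C * H) * Cᴴ) + gibbsState β H (C * (H * Cᴴ - Cᴴ * H)) = 0 := by
      rw [← map_add, h1, h0]
    exact eq_neg_of_add_eq_zero_left h2
  have hadj : ∀ i j, ‖((star hH.eigenvectorUnitary : Matrix n n ℂ) * Cᴴ *
      (hH.eigenvectorUnitary : Matrix n n ℂ)) i j‖ = ‖C' j i‖ := by
    intro i j
    rw [star_coe_mul_conjTranspose_mul hH C, ← hC', conjTranspose_apply, norm_star]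
  rw [map_sub, hstat, sub_neg_eq_add, Complex.add_re, hH.re_gibbsState, hH.re_gibbsState, ← mul_add,
    re_trace_gibbsWeight_mul_conjTranspose_mul_comm hH β C,
    re_trace_gibbsWeight_mul_conjTranspose_mul_comm hH β Cᴴ, ← hC', ← hE]
  congr 1
  simp_rw [hadj]
  rw [show (∑ i, ∑ j, Real.exp (-β * E j) * (E i - E j) * ‖C' j i‖ ^ 2) =
      ∑ i, ∑ j, Real.exp (-β * E i) * (E j - E i) * ‖C' i j‖ ^ 2 from Finset.sum_comm,
    ← sum_add_distrib]
  refine sum_congr rfl fun i _ => ?_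
  rw [← sum_add_distrib]
  refine sum_congr rfl fun j _ => ?_
  simp only [neg_mul]
  ring

/-- `Re ⟨[Cᴴ, [H, C]]⟩_β ≥ 0` for every `C` and `β ≥ 0` (termwise `(Eⱼ − Eᵢ)(wᵢ − wⱼ) ≥ 0`).
[cite: DLS1978, §2 after eq. (28)] -/
theorem re_gibbsState_doubleComm_general_nonneg (hH : H.IsHermitian) (C : Matrix n n ℂ) {β : ℝ}
    (hβ : 0 ≤ β) :
    0 ≤ (gibbsState β H (Cᴴ * (H * C - C * H) - (H * C - C * H) * Cᴴ)).re := by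
  rw [re_gibbsState_doubleComm_general hH C β]
  exact mul_nonneg (inv_nonneg.2 (sum_nonneg fun i _ => (Real.exp_pos _).le))
    (sum_nonneg fun i _ => sum_nonneg fun j _ =>
      mul_nonneg (sq_nonneg _) (sub_mul_exp_sub_exp_nonneg hβ _ _))

/-- **Pair-sum form of `Re (Aᴴ, A)`** with transposed indices:
`Re (Aᴴ, A)_β = Z⁻¹ Σᵢⱼ |A′ⱼᵢ|² K_β(Eᵢ, Eⱼ)` (`re_duhamel_conjTranspose_eq` at `Aᴴ`, using
`|(Aᴴ)′ᵢⱼ| = |A′ⱼᵢ|`). [cite: DLS1978, eq. (35)] -/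
theorem re_duhamel_conjTranspose_mul_self_eq (hH : H.IsHermitian) (A : Matrix n n ℂ) (β : ℝ) :
    (duhamel β H Aᴴ A).re = (∑ i, Real.exp (-(β * hH.eigenvalues i)))⁻¹ *
      ∑ i, ∑ j, ‖((star hH.eigenvectorUnitary : Matrix n n ℂ) * A *
          (hH.eigenvectorUnitary : Matrix n n ℂ)) j i‖ ^ 2 *
            duhamelKernel β (hH.eigenvalues i) (hH.eigenvalues j) := by
  have h := re_duhamel_conjTranspose_eq hH Aᴴ β
  rw [conjTranspose_conjTranspose] at h
  rw [h, star_coe_mul_conjTranspose_mul hH A]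
  refine congrArg (fun t => (∑ i, Real.exp (-(β * hH.eigenvalues i)))⁻¹ * t) ?_
  refine sum_congr rfl fun i _ => sum_congr rfl fun j _ => ?_
  rw [conjTranspose_apply, norm_star]

/-- **Bogoliubov's inequality, sharp (Duhamel) form, for arbitrary observables.** For Hermitian
`H`, `β ≥ 0` and any `A C : Matrix n n ℂ`,
`|⟨CA − AC⟩_β|² ≤ β · Re (Aᴴ, A)_β · Re ⟨[Cᴴ,[H,C]]⟩_β`, where `(Aᴴ, A)_β = Matrix.duhamel β H Aᴴ A`
is the Duhamel two-point function `Z⁻¹∫₀¹ tr(Aᴴ e^{-sβH} A e^{-(1-s)βH}) ds` and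
`[Cᴴ,[H,C]] = Cᴴ(HC − CH) − (HC − CH)Cᴴ`. This is the Schwarz inequality (22′) for the Duhamel
scalar product at `B = [Cᴴ, βH]` together with `⟨[C, A]⟩ = (A…, [Cᴴ,βH])`-type identity (27) and
`([Cᴴ,βH],[Cᴴ,βH]) = β⟨[Cᴴ,[H,C]]⟩`. Proof: pair sums `Z⟨CA − AC⟩ = Σᵢⱼ (wᵢ − wⱼ) C′ᵢⱼ A′ⱼᵢ`,
the per-pair identity `(wᵢ − wⱼ)² = β K(Eᵢ,Eⱼ)(Eⱼ − Eᵢ)(wᵢ − wⱼ)` (`Matrix.sq_exp_sub_exp_eq`),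
Cauchy–Schwarz, `Σ |A′ⱼᵢ|² K(Eᵢ,Eⱼ) = Z · Re(Aᴴ,A)` (`re_duhamel_conjTranspose_eq` at `Aᴴ`) and
`re_gibbsState_doubleComm_general`. [cite: DLS1978, §2 eqs. (22′), (27), (28)] -/
theorem bogoliubov_inequality_duhamel_general (hH : H.IsHermitian) (A C : Matrix n n ℂ) {β : ℝ}
    (hβ : 0 ≤ β) :
    ‖gibbsState β H (C * A - A * C)‖ ^ 2 ≤
      β * (duhamel β H Aᴴ A).re *
        (gibbsState β H (Cᴴ * (H * C - C * H) - (H * C - C * H) * Cᴴ)).re := by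
  rcases isEmpty_or_nonempty n with hn | hn
  · have h0 : ∀ X : Matrix n n ℂ, gibbsState β H X = 0 := fun X => by
      rw [gibbsState_apply]
      simp [Matrix.trace]
    simp [h0]
  set U := (hH.eigenvectorUnitary : Matrix n n ℂ) with hU
  set E := hH.eigenvalues with hE
  set W : n → ℝ := fun i => Real.exp (-(β * E i)) with hW
  set Zr : ℝ := ∑ i, W i with hZr
  set A' : Matrix n n ℂ := (star hH.eigenvectorUnitary : Matrix n n ℂ) * A * U with hA'
  set C' : Matrix n n ℂ := (star hH.eigenvectorUnitary : Matrix n n ℂ) * C * U with hC'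
  set a : n → n → ℝ := fun i j => ‖A' j i‖ with ha
  set c' : n → n → ℝ := fun i j => ‖C' i j‖ with hc'
  set c : n → n → ℝ := fun i j => (E j - E i) * (W i - W j) with hc
  set K : n → n → ℝ := fun i j => duhamelKernel β (E i) (E j) with hK
  have hZr0 : 0 < Zr := hH.sum_exp_pos β
  have hc0 : ∀ i j, 0 ≤ c i j := fun i j => sub_mul_exp_sub_exp_nonneg hβ (E i) (E j)
  have hK0 : ∀ i j, 0 ≤ K i j := fun i j => (duhamelKernel_pos β (E i) (E j)).le
  -- the left-hand side as a pair sum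
  have hL : gibbsState β H (C * A - A * C) =
      (Zr : ℂ)⁻¹ * ∑ i, ∑ j, ((W i - W j : ℝ) : ℂ) * (C' i j * A' j i) := by
    rw [gibbsState_apply, hH.partitionFn_eq_ofReal, trace_gibbsWeight_mul_commutator_eq_sum hH A C β]
  have hLn : ‖gibbsState β H (C * A - A * C)‖ ≤
      Zr⁻¹ * ∑ i, ∑ j, |W i - W j| * (c' i j * a i j) := by
    rw [hL, norm_mul, norm_inv, Complex.norm_real, Real.norm_eq_abs, abs_of_pos hZr0]
    refine mul_le_mul_of_nonneg_left ?_ (inv_nonneg.2 hZr0.le)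
    refine (norm_sum_le _ _).trans (sum_le_sum fun i _ => ?_)
    refine (norm_sum_le _ _).trans (sum_le_sum fun j _ => ?_)
    rw [norm_mul, norm_mul, Complex.norm_real, Real.norm_eq_abs]
  -- the Duhamel factor as a pair sum
  have hb : (duhamel β H Aᴴ A).re = Zr⁻¹ * ∑ i, ∑ j, a i j ^ 2 * K i j := by
    rw [re_duhamel_conjTranspose_mul_self_eq hH A β]
  have hcc : (gibbsState β H (Cᴴ * (H * C - C * H) - (H * C - C * H) * Cᴴ)).re =
      Zr⁻¹ * ∑ i, ∑ j, c' i j ^ 2 * c i j := by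
    rw [re_gibbsState_doubleComm_general hH C β]
  -- per-pair identity and Cauchy–Schwarz
  have hpair : ∀ i j, |W i - W j| * (c' i j * a i j) =
      Real.sqrt (β * (a i j ^ 2 * K i j)) * Real.sqrt (c' i j ^ 2 * c i j) := by
    intro i j
    have ha0 : 0 ≤ a i j := norm_nonneg _
    have hc'0 : 0 ≤ c' i j := norm_nonneg _
    rw [← Real.sqrt_mul (mul_nonneg hβ (mul_nonneg (sq_nonneg _) (hK0 i j))),
      show β * (a i j ^ 2 * K i j) * (c' i j ^ 2 * c i j) =
        (c' i j * a i j) ^ 2 * (β * K i j * c i j) by ring,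
      Real.sqrt_mul (sq_nonneg _), Real.sqrt_sq (mul_nonneg hc'0 ha0), mul_comm]
    congr 1
    rw [← Real.sqrt_sq_eq_abs]
    congr 1
    exact sq_exp_sub_exp_eq β (E i) (E j)
  have hsum : ∑ i, ∑ j, |W i - W j| * (c' i j * a i j) ≤
      Real.sqrt (∑ i, ∑ j, β * (a i j ^ 2 * K i j)) *
        Real.sqrt (∑ i, ∑ j, c' i j ^ 2 * c i j) := by
    calc ∑ i, ∑ j, |W i - W j| * (c' i j * a i j)
        = ∑ i, ∑ j, Real.sqrt (β * (a i j ^ 2 * K i j)) * Real.sqrt (c' i j ^ 2 * c i j) :=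
          sum_congr rfl fun i _ => sum_congr rfl fun j _ => hpair i j
      _ ≤ _ := by
          have hCS := Real.sum_sqrt_mul_sqrt_le (univ : Finset (n × n))
            (f := fun p => β * (a p.1 p.2 ^ 2 * K p.1 p.2))
            (g := fun p => c' p.1 p.2 ^ 2 * c p.1 p.2)
            (fun p => mul_nonneg hβ (mul_nonneg (sq_nonneg _) (hK0 _ _)))
            (fun p => mul_nonneg (sq_nonneg _) (hc0 _ _))
          simpa only [Fintype.sum_prod_type] using hCS
  -- assemble
  set G : ℝ := ∑ i, ∑ j, a i j ^ 2 * K i j with hG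
  set D : ℝ := ∑ i, ∑ j, c' i j ^ 2 * c i j with hD
  have hG0 : 0 ≤ G := sum_nonneg fun i _ => sum_nonneg fun j _ =>
    mul_nonneg (sq_nonneg _) (hK0 _ _)
  have hD0 : 0 ≤ D := sum_nonneg fun i _ => sum_nonneg fun j _ =>
    mul_nonneg (sq_nonneg _) (hc0 _ _)
  have hβG : ∑ i, ∑ j, β * (a i j ^ 2 * K i j) = β * G := by
    rw [hG, mul_sum]
    refine sum_congr rfl fun i _ => ?_
    rw [mul_sum]
  rw [hβG] at hsum
  have hZinv : 0 ≤ Zr⁻¹ := inv_nonneg.2 hZr0.le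
  have hn0 : 0 ≤ ‖gibbsState β H (C * A - A * C)‖ := norm_nonneg _
  have hbound : ‖gibbsState β H (C * A - A * C)‖ ≤
      Zr⁻¹ * (Real.sqrt (β * G) * Real.sqrt D) :=
    hLn.trans (mul_le_mul_of_nonneg_left hsum hZinv)
  rw [hb, hcc]
  calc ‖gibbsState β H (C * A - A * C)‖ ^ 2
      ≤ (Zr⁻¹ * (Real.sqrt (β * G) * Real.sqrt D)) ^ 2 := pow_le_pow_left₀ hn0 hbound 2
    _ = β * (Zr⁻¹ * G) * (Zr⁻¹ * D) := by
        rw [mul_pow, mul_pow, Real.sq_sqrt (mul_nonneg hβ hG0), Real.sq_sqrt hD0]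
        ring

/-- **Bogoliubov's inequality for arbitrary observables** ([DLS1978] (28)). For Hermitian `H`,
`β ≥ 0` and any `A C : Matrix n n ℂ`,
`|⟨CA − AC⟩_β|² ≤ β · ½(Re⟨AAᴴ⟩_β + Re⟨AᴴA⟩_β) · Re⟨[Cᴴ,[H,C]]⟩_β`, i.e. Dyson–Lieb–Simon's
`|⟨[A,B]⟩|² ≤ ⟨[A*,[βH,A]]⟩ · ½⟨B*B + BB*⟩` with their `(A, B)` our `(C, A)`. From the sharp form by
`Re(Aᴴ, A) ≤ ½(Re⟨AᴴA⟩ + Re⟨AAᴴ⟩)` ([DLS1978] (25), tree `re_duhamel_conjTranspose_le`) and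
`Re⟨[Cᴴ,[H,C]]⟩ ≥ 0`. For Hermitian `A`, `C` this is `bogoliubov_inequality`.
[cite: DLS1978, §2 eqs. (25), (28)] -/
theorem bogoliubov_inequality_general (hH : H.IsHermitian) (A C : Matrix n n ℂ) {β : ℝ}
    (hβ : 0 ≤ β) :
    ‖gibbsState β H (C * A - A * C)‖ ^ 2 ≤
      β * (((gibbsState β H (A * Aᴴ)).re + (gibbsState β H (Aᴴ * A)).re) / 2) *
        (gibbsState β H (Cᴴ * (H * C - C * H) - (H * C - C * H) * Cᴴ)).re := by
  have hb : (duhamel β H Aᴴ A).re ≤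
      ((gibbsState β H (A * Aᴴ)).re + (gibbsState β H (Aᴴ * A)).re) / 2 := by
    have h := re_duhamel_conjTranspose_le hH Aᴴ β
    rw [conjTranspose_conjTranspose] at h
    linarith
  refine (bogoliubov_inequality_duhamel_general hH A C hβ).trans ?_
  exact mul_le_mul_of_nonneg_right (mul_le_mul_of_nonneg_left hb hβ)
    (re_gibbsState_doubleComm_general_nonneg hH C hβ)

/-- **Bogoliubov's inequality for arbitrary observables, anticommutator form**:
`|⟨CA − AC⟩_β|² ≤ ½β · Re⟨AAᴴ + AᴴA⟩_β · Re⟨[Cᴴ,[H,C]]⟩_β`. [cite: DLS1978, §2 eq. (28)] -/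
theorem bogoliubov_inequality_general' (hH : H.IsHermitian) (A C : Matrix n n ℂ) {β : ℝ}
    (hβ : 0 ≤ β) :
    ‖gibbsState β H (C * A - A * C)‖ ^ 2 ≤
      β / 2 * (gibbsState β H (A * Aᴴ + Aᴴ * A)).re *
        (gibbsState β H (Cᴴ * (H * C - C * H) - (H * C - C * H) * Cᴴ)).re := by
  have h := bogoliubov_inequality_general hH A C hβ
  rw [map_add, Complex.add_re]
  calc ‖gibbsState β H (C * A - A * C)‖ ^ 2 ≤ _ := h
    _ = _ := by ring

/-- **The linear (row) form of Bogoliubov's inequality.** For Hermitian `H`, `β ≥ 0` and any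
`A C : Matrix n n ℂ`,
`0 ≤ Re⟨AAᴴ + AᴴA⟩_β + 2 Re⟨CA − AC⟩_β + ½β Re⟨[Cᴴ,[H,C]]⟩_β`
(from `|z|² ≤ PQ`, `P, Q ≥ 0` ⇒ `2|Re z| ≤ P + Q`). Read over all `A = Σ uᵢ aᵢ`, `C = Σ ηⱼ aⱼ` in
the span of a template family `(aᵢ)` this says that the Bogoliubov block
`[[⟨{aᵢ…}⟩], [⟨[…]⟩]; [⟨[…]⟩], ½β⟨[aᴴ,[H,a]]…⟩]` is positive semidefinite — an exact constraint on the
Gibbs state that is LINEAR in its moments (hubbard-thermal THERMAL-SOURCES §2g, row family `bog`).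
[cite: DLS1978, §2 eq. (28)] -/
theorem bogoliubov_row_nonneg (hH : H.IsHermitian) (A C : Matrix n n ℂ) {β : ℝ} (hβ : 0 ≤ β) :
    0 ≤ (gibbsState β H (A * Aᴴ + Aᴴ * A)).re + 2 * (gibbsState β H (C * A - A * C)).re +
      β / 2 * (gibbsState β H (Cᴴ * (H * C - C * H) - (H * C - C * H) * Cᴴ)).re := by
  set z : ℂ := gibbsState β H (C * A - A * C) with hz
  set P : ℝ := (gibbsState β H (A * Aᴴ + Aᴴ * A)).re with hP
  set Q : ℝ := β / 2 * (gibbsState β H (Cᴴ * (H * C - C * H) - (H * C - C * H) * Cᴴ)).re with hQ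
  have hP0 : 0 ≤ P := by
    rw [hP, map_add, Complex.add_re, hH.re_gibbsState, hH.re_gibbsState, ← mul_add,
      re_trace_gibbsWeight_mul_mul_conjTranspose hH β A, re_trace_gibbsWeight_mul_conjTranspose_mul hH β A]
    exact mul_nonneg (inv_nonneg.2 (sum_nonneg fun i _ => (Real.exp_pos _).le))
      (add_nonneg (sum_nonneg fun i _ => sum_nonneg fun j _ => mul_nonneg (Real.exp_pos _).le (sq_nonneg _))
        (sum_nonneg fun i _ => sum_nonneg fun j _ => mul_nonneg (Real.exp_pos _).le (sq_nonneg _)))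
  have hQ0 : 0 ≤ Q := mul_nonneg (by positivity) (re_gibbsState_doubleComm_general_nonneg hH C hβ)
  have hzPQ : ‖z‖ ^ 2 ≤ P * Q := by
    have h := bogoliubov_inequality_general' hH A C hβ
    calc ‖z‖ ^ 2 ≤ _ := h
      _ = P * Q := by rw [hP, hQ]; ring
  have hre : |z.re| ≤ ‖z‖ := Complex.abs_re_le_norm z
  have h2 : 2 * ‖z‖ ≤ P + Q := by
    have hsq : (2 * ‖z‖) ^ 2 ≤ (P + Q) ^ 2 := by nlinarith [sq_nonneg (P - Q), norm_nonneg z]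
    exact le_of_pow_le_pow_left₀ two_ne_zero (add_nonneg hP0 hQ0) hsq
  have hre' := abs_le.1 hre
  linarith [hre'.1]

end Spectral

end Literature.MathematicalPhysics.QuantumLattice
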